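import Summits.AtomisticToContinuum.HydrodynamicLimit.Theorems.MourreKoopmanChargesLinearToEntropyInBandStressRungPrep
import Summits.AtomisticToContinuum.HydrodynamicLimit.Theorems.KineticWindowGronwall.Negative.ActivityDummy
import HarnessLib

/-!
# `OneBodyCompleteness → EquilibriumStressVarianceDecay`: the kinetic shear-stress linear rung of the crux
# `LinearToEntropyInBand` (stmt-AtomisticToContinuum-17740), route `MourreKoopmanCharges`

Support file 2/2 (`--supports stmt-AtomisticToContinuum-17740`, registered stub `stub_kineticStressLinearRung`) of the
line `registered`, skeleton v4 (`Cruxes/LinearToEntropyInBand/Lines/birth.lean`, lead prover-line-…-17740-c3-0).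

The crux is the nonlinear bridge `OneBodyCompleteness → StressStrongMixing → RelEntropyVanishingInBand`; its
load-bearing stub 1 (`stub_visibleFluxGibbsianity`) upgrades the two LINEAR outputs of the Mourre package to visible
local flux-Gibbsianity (an exponential-moment bound on window-averaged, block-recentred currents under the invariant
Gibbs law).  The FIRST-ORDER (quadratic, `L²`) content of that upgrade, for the kinetic shear-stress row, is the
statement that window averages of the empirical kinetic shear stress have `o((N+1)⁻¹)` variance under the
homogeneous Gibbs law, `N`-uniformly, once the kinetic window is long — which is VERBATIM the route item
`OneFlightGossipEngine.EquilibriumStressVarianceDecay` (stmt-AtomisticToContinuum-9531, rung C3 of route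
OneFlightGossipEngine; reduced in the tree to the shared `L²` milestone `FastObservableMeanErgodic`, both open).
This file PROVES it from the route's typed crux `MourreKoopmanCharges.OneBodyCompleteness` (stmt-9583: zero
Euler-window Drude weight, in the signed CESÀRO form `|S⁻¹∫₀^S (N+1)E[A_h(χ)∘Φ_{s(N+1)^{-1/3}} · A_h(χ)] ds| ≤ δ`
for `S ≥ S₀(δ)`, `N ≥ N₀(S)`), validating in Lean the planner's remark that 9583 is "`L²`-equivalent (Fejér vs
Cesàro means …) to `FastObservableMeanErgodic`" in the direction the bridge consumes:

* the `OneBodyCompleteness` correlation at `h = v⁰v¹`, `χ = φ` IS `(N+1) · C_N(s(N+1)^{-1/3})` for the stress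
  autocorrelation `C_N` of `…EquilibriumStressVarianceDecayCorrDecay` (`integral_shearGerm_empiricalMeasure`);
  `(N+1)|C_N(t)| ≤ θ²K²E_γ‖w‖⁴` (`succ_mul_abs_corr_le`: `abs_corr_le_integral_sq` + `lintegral_stress_sq_le`);
* `fejerStress_of_oneBodyCompleteness`: the Fejér form of the item at unit activity, by `fejer_le_of_cesaro`
  (file 1/2), measurability `measurable_corr`, and the change of variables `t = s(N+1)^{-1/3}`;
* `stub_kineticStressLinearRung : OneBodyCompleteness → EquilibriumStressVarianceDecay`, through the landed
  equivalence `equilibriumStressVarianceDecay_iff_fejer_corr_decay` and the activity dummy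
  `KineticWindowGronwallNegative.localGibbsLaw_const_activity`.

References: H. Spohn, *Large Scale Dynamics of Interacting Particles* (1991), Part I §7.1 (Drude weights / projected
currents) and Part II §1.7 (Green–Kubo); module docstrings of `…EquilibriumStressVarianceDecay{GreenKubo,CorrDecay}`.
-/

noncomputable section

namespace Summit.AtomisticToContinuum.HydrodynamicLimit.Theorems.LTEInBand

open MeasureTheory ProbabilityTheory Filter Topology Set
open Literature.Analysis.FluidPDE Literature.MathematicalPhysics.KineticTheory
open scoped InnerProductSpace ENNReal Interval
open Summit.AtomisticToContinuum.HydrodynamicLimit.Theorems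
open BoltzmannGreenKuboOrthMomentum BoltzmannGreenKuboForallN EquilibriumStressVarianceDecayC3
open Summit.AtomisticToContinuum.HydrodynamicLimit.Theses

/-! ## § 1 Identification of the `OneBodyCompleteness` correlation with the stress autocorrelation -/

section Identification

variable {σ : ℝ} {N : ℕ}

/-- **The one-body field of `OneBodyCompleteness` at `h = v⁰v¹` IS the empirical kinetic shear stress `𝐒`**:
`∫ χ(x) h(v) dμ_z(x,v) = (N+1)⁻¹ Σᵢ χ(xᵢ) vᵢ⁰vᵢ¹`. [folklore] -/
theorem integral_shearGerm_empiricalMeasure (φ : T3 → ℝ) (z : Config (N + 1) (Fin 3) T3) :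
    ∫ y, φ y.1 * (fun v : V3 => v 0 * v 1) y.2 ∂(empiricalMeasure z) = 𝐒[N, φ, z] := by
  rw [integral_empiricalMeasure]
  push_cast
  rfl

/-- **`N`-uniform static bound of the stress autocorrelation**: `(N+1) |C_N(t)| ≤ θ² K² E_γ‖w‖⁴` for
`|φ| ≤ K` under the homogeneous Gibbs law (Cauchy–Schwarz + invariance, then the Gaussian statics of
`lintegral_stress_sq_le`). [folklore] -/
theorem succ_mul_abs_corr_le {θ : ℝ} (hθ : 0 < θ)
    (Φ : HardSphereFlow (Torus.geometry (Fin 3)) (hsDiameter σ N) (N + 1))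
    [IsProbabilityMeasure (localGibbsLaw σ (fun _ => (1 : ℝ)) (fun _ => 0) (fun _ => θ) N Φ)]
    {φ : T3 → ℝ} (hφ : Continuous φ) {K : ℝ} (hK : ∀ x, |φ x| ≤ K) (t : ℝ) :
    ((N : ℝ) + 1) * |∫ z, 𝐒[N, φ, z] * 𝐒[N, φ, Φ.flow t z]
        ∂(localGibbsLaw σ (fun _ => (1 : ℝ)) (fun _ => 0) (fun _ => θ) N Φ)| ≤
      θ ^ 2 * (K ^ 2 * ∫ w : V3, ‖w‖ ^ 4 ∂stdGaussian V3) := by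
  set G := localGibbsLaw σ (fun _ => (1 : ℝ)) (fun _ => (0 : V3)) (fun _ => θ) N Φ with hGdef
  have hNpos : (0 : ℝ) < (N : ℝ) + 1 := by positivity
  have h2 : MemLp (fun z : Config (N + 1) (Fin 3) T3 => 𝐒[N, φ, z]) 2 G := memLp_two_stress zero_le_one hθ Φ hφ hK
  have hcorr := abs_corr_le_integral_sq 1 θ 0 Φ (measurable_stress hφ) h2 t
  -- the real second moment through the `ℝ≥0∞` statics
  have hsq : ∫ z, 𝐒[N, φ, z] ^ 2 ∂G ≤ ((N : ℝ) + 1)⁻¹ * (θ ^ 2 * (K ^ 2 * ∫ w : V3, ‖w‖ ^ 4 ∂stdGaussian V3)) := by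
    have hM4 : 0 ≤ ∫ w : V3, ‖w‖ ^ 4 ∂stdGaussian V3 := integral_nonneg fun w => by positivity
    have hnn : 0 ≤ ((N : ℝ) + 1)⁻¹ * (θ ^ 2 * (K ^ 2 * ∫ w : V3, ‖w‖ ^ 4 ∂stdGaussian V3)) := by positivity
    rw [integral_eq_lintegral_of_nonneg_ae (Eventually.of_forall fun z => sq_nonneg _)
      ((measurable_stress hφ).pow_const 2).aestronglyMeasurable]
    refine (ENNReal.toReal_mono ENNReal.ofReal_ne_top (lintegral_stress_sq_le zero_le_one hθ Φ hφ hK)).trans ?_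
    rw [ENNReal.toReal_ofReal hnn]
  calc ((N : ℝ) + 1) * |∫ z, 𝐒[N, φ, z] * 𝐒[N, φ, Φ.flow t z] ∂G|
      ≤ ((N : ℝ) + 1) * (((N : ℝ) + 1)⁻¹ * (θ ^ 2 * (K ^ 2 * ∫ w : V3, ‖w‖ ^ 4 ∂stdGaussian V3))) :=
        mul_le_mul_of_nonneg_left (hcorr.trans hsq) hNpos.le
    _ = θ ^ 2 * (K ^ 2 * ∫ w : V3, ‖w‖ ^ 4 ∂stdGaussian V3) := by
        field_simp

end Identification

/-! ## § 3 The rung: `OneBodyCompleteness → EquilibriumStressVarianceDecay` -/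

section Rung

/-- **The Fejér form of the item from smallness of the rescaled Fejér kernel means** (the common final step of
every rung landing on `EquilibriumStressVarianceDecay`): with the stress autocorrelation
`C_N(t) = ∫ 𝐒 · 𝐒∘Φ_t dG_N` under `localGibbsLaw σ 1 0 θ` and the kinetic-time kernel `K_N(s) = (N+1) C_N(s(N+1)^{-1/3})`,
if `∀ ε > 0 ∃ T₀ ∀ τ ≥ T₀ ∃ N₀ ∀ N ≥ N₀, 2τ⁻² ∫₀^τ (τ − s) K_N(s) ds ≤ ε` then
`lim_{τ→∞} limsup_N ofReal((N+1) · 2w⁻² ∫₀ʷ (w − t) C_N(t) dt) = 0`, `w = τ(N+1)^{-1/3}` (change of variables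
`t = s(N+1)^{-1/3}`, then `limsup ≤` an eventual bound). [folklore] -/
theorem fejerStress_of_kernel_small {θ σ : ℝ}
    (Φ : (N : ℕ) → HardSphereFlow (Torus.geometry (Fin 3)) (hsDiameter σ N) (N + 1)) (φ : T3 → ℝ)
    (hsmall : ∀ ε : ℝ, 0 < ε → ∃ T₀ : ℝ, 0 < T₀ ∧ ∀ τ : ℝ, T₀ ≤ τ → ∃ N₀ : ℕ, ∀ N : ℕ, N₀ ≤ N →
      2 * τ⁻¹ ^ 2 * ∫ s in (0 : ℝ)..τ, (τ - s) * (((N : ℝ) + 1) *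
        ∫ z, 𝐒[N, φ, z] * 𝐒[N, φ, (Φ N).flow (s * ((N : ℝ) + 1) ^ (-(1 / 3 : ℝ))) z]
          ∂(localGibbsLaw σ (fun _ => (1 : ℝ)) (fun _ => 0) (fun _ => θ) N (Φ N))) ≤ ε) :
    Tendsto (fun τ : ℝ => Filter.limsup (fun N : ℕ => ENNReal.ofReal (((N : ℝ) + 1) *
      (2 * (τ * ((N : ℝ) + 1) ^ (-(1 / 3 : ℝ)))⁻¹ ^ 2 *
        ∫ t in (0 : ℝ)..(τ * ((N : ℝ) + 1) ^ (-(1 / 3 : ℝ))), (τ * ((N : ℝ) + 1) ^ (-(1 / 3 : ℝ)) - t) *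
          ∫ z, 𝐒[N, φ, z] * 𝐒[N, φ, (Φ N).flow t z]
            ∂(localGibbsLaw σ (fun _ => (1 : ℝ)) (fun _ => 0) (fun _ => θ) N (Φ N))))) atTop) atTop (𝓝 0) := by
  set c : ℕ → ℝ := fun N => ((N : ℝ) + 1) ^ (-(1 / 3 : ℝ)) with hc
  have hcpos : ∀ N, 0 < c N := fun N => Real.rpow_pos_of_pos (by positivity) _
  set C : ℕ → ℝ → ℝ := fun N t => ∫ z, 𝐒[N, φ, z] * 𝐒[N, φ, (Φ N).flow t z]
    ∂(localGibbsLaw σ (fun _ => (1 : ℝ)) (fun _ => 0) (fun _ => θ) N (Φ N)) with hC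
  set Kf : ℕ → ℝ → ℝ := fun N s => ((N : ℝ) + 1) * C N (s * c N) with hKf
  -- change of variables `t = s · c N` in the item's Fejér functional
  have hcv : ∀ N : ℕ, ∀ τ : ℝ, ((N : ℝ) + 1) * (2 * (τ * c N)⁻¹ ^ 2 *
      ∫ t in (0 : ℝ)..(τ * c N), (τ * c N - t) * C N t) = 2 * τ⁻¹ ^ 2 * ∫ s in (0 : ℝ)..τ, (τ - s) * Kf N s := by
    intro N τ
    have hcN := (hcpos N).ne'
    have hsub : ∫ s in (0 : ℝ)..τ, (τ * c N - s * c N) * C N (s * c N) =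
        (c N)⁻¹ * ∫ t in (0 * c N)..(τ * c N), (τ * c N - t) * C N t := by
      rw [← smul_eq_mul (c N)⁻¹, ← intervalIntegral.integral_comp_mul_right (fun t => (τ * c N - t) * C N t) hcN]
    rw [zero_mul] at hsub
    have hKint : ∫ s in (0 : ℝ)..τ, (τ - s) * Kf N s =
        ((N : ℝ) + 1) * (c N)⁻¹ * ∫ s in (0 : ℝ)..τ, (τ * c N - s * c N) * C N (s * c N) := by
      rw [mul_assoc, ← intervalIntegral.integral_const_mul, ← intervalIntegral.integral_const_mul]
      refine intervalIntegral.integral_congr fun s _ => ?_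
      simp only [hKf]
      field_simp
    rw [hKint, hsub]
    field_simp
  -- conclude: `∀ ε > 0`, eventually in `τ`, `limsup_N ofReal(…) ≤ ε`
  rw [ENNReal.tendsto_nhds_zero]
  intro ε hε
  by_cases hεtop : ε = ⊤
  · exact Eventually.of_forall fun τ => hεtop ▸ le_top
  have hεr : 0 < ε.toReal := ENNReal.toReal_pos hε.ne' hεtop
  obtain ⟨T₀, hT₀, hT⟩ := hsmall ε.toReal hεr
  filter_upwards [eventually_ge_atTop T₀] with τ hτ
  obtain ⟨N₀, hN₀⟩ := hT τ hτ
  refine Filter.limsup_le_of_le (h := ?_)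
  filter_upwards [eventually_ge_atTop N₀] with N hN
  rw [hcv N τ]
  calc ENNReal.ofReal (2 * τ⁻¹ ^ 2 * ∫ s in (0 : ℝ)..τ, (τ - s) * Kf N s)
      ≤ ENNReal.ofReal ε.toReal := ENNReal.ofReal_le_ofReal (hN₀ N hN)
    _ = ε := ENNReal.ofReal_toReal hεtop

/-- **The Fejér form of `EquilibriumStressVarianceDecay` at unit activity follows from `OneBodyCompleteness`**:
for `θ > 0` there is `σ₀ > 0` such that for `0 < σ < σ₀`, every flow family and every continuous `φ`,
`lim_{τ→∞} limsup_N ofReal((N+1) · 2w⁻² ∫₀ʷ (w − t) C_N(t) dt) = 0`, `w = τ(N+1)^{-1/3}`, `C_N` the stress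
autocorrelation under `localGibbsLaw σ 1 0 θ`.  Proof: `OneBodyCompleteness` at `h = v⁰v¹`, `χ = φ` gives the
Cesàro hypothesis of `fejer_le_of_cesaro` for `K_N(s) = (N+1) C_N(s(N+1)^{-1/3})` (`integral_shearGerm_empiricalMeasure`);
`|K_N| ≤ θ²K²E_γ‖w‖⁴` (`succ_mul_abs_corr_le`); `K_N` is measurable (`measurable_corr`); then
`fejerStress_of_kernel_small`. [folklore] -/
theorem fejerStress_of_oneBodyCompleteness (hOBC : MourreKoopmanCharges.OneBodyCompleteness) :
    ∀ θ : ℝ, 0 < θ → ∃ σ₀ : ℝ, 0 < σ₀ ∧ ∀ σ : ℝ, 0 < σ → σ < σ₀ →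
      ∀ Φ : (N : ℕ) → HardSphereFlow (Torus.geometry (Fin 3)) (hsDiameter σ N) (N + 1),
      ∀ φ : T3 → ℝ, Continuous φ →
        Tendsto (fun τ : ℝ => Filter.limsup (fun N : ℕ => ENNReal.ofReal (((N : ℝ) + 1) *
          (2 * (τ * ((N : ℝ) + 1) ^ (-(1 / 3 : ℝ)))⁻¹ ^ 2 *
            ∫ t in (0 : ℝ)..(τ * ((N : ℝ) + 1) ^ (-(1 / 3 : ℝ))), (τ * ((N : ℝ) + 1) ^ (-(1 / 3 : ℝ)) - t) *
              ∫ z, 𝐒[N, φ, z] * 𝐒[N, φ, (Φ N).flow t z]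
                ∂(localGibbsLaw σ (fun _ => (1 : ℝ)) (fun _ => 0) (fun _ => θ) N (Φ N))))) atTop) atTop (𝓝 0) := by
  intro θ hθ
  obtain ⟨σ₁, hσ₁, H⟩ := hOBC
  refine ⟨min σ₁ (1 / 2), lt_min hσ₁ (by norm_num), fun σ hσ hσlt Φ φ hφ => ?_⟩
  have hσ₁' : σ < σ₁ := lt_of_lt_of_le hσlt (min_le_left _ _)
  have hσhalf : σ ≤ 1 / 2 := (lt_of_lt_of_le hσlt (min_le_right _ _)).le
  obtain ⟨Kφ, -, hKφ⟩ := exists_forall_abs_le_of_continuous hφ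
  haveI hprob : ∀ N : ℕ, IsProbabilityMeasure (localGibbsLaw σ (fun _ => (1 : ℝ)) (fun _ => (0 : V3)) (fun _ => θ) N (Φ N)) :=
    fun N => isProbabilityMeasure_localGibbsLaw continuous_const continuous_const continuous_const
      (fun _ => one_pos) (fun _ => hθ) hσhalf N (Φ N)
  refine fejerStress_of_kernel_small Φ φ ?_
  -- notation
  set c : ℕ → ℝ := fun N => ((N : ℝ) + 1) ^ (-(1 / 3 : ℝ)) with hc
  set C : ℕ → ℝ → ℝ := fun N t => ∫ z, 𝐒[N, φ, z] * 𝐒[N, φ, (Φ N).flow t z]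
    ∂(localGibbsLaw σ (fun _ => (1 : ℝ)) (fun _ => 0) (fun _ => θ) N (Φ N)) with hC
  set Kf : ℕ → ℝ → ℝ := fun N s => ((N : ℝ) + 1) * C N (s * c N) with hKf
  -- the three inputs of `fejer_le_of_cesaro`
  have hKm : ∀ N, Measurable (Kf N) := by
    intro N
    have hm := measurable_corr 1 θ 0 (Φ N) (measurable_stress (N := N) hφ)
    exact (hm.comp (measurable_id.mul_const (c N))).const_mul _
  set B : ℝ := θ ^ 2 * (Kφ ^ 2 * ∫ w : V3, ‖w‖ ^ 4 ∂stdGaussian V3) with hB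
  have hB0 : 0 ≤ B := by
    have hM4 : 0 ≤ ∫ w : V3, ‖w‖ ^ 4 ∂stdGaussian V3 := integral_nonneg fun w => by positivity
    positivity
  have hKB : ∀ N s, |Kf N s| ≤ B := by
    intro N s
    rw [hKf]
    dsimp only
    rw [abs_mul, abs_of_pos (by positivity : (0 : ℝ) < (N : ℝ) + 1)]
    exact succ_mul_abs_corr_le hθ (Φ N) hφ hKφ _
  have hces : ∀ δ : ℝ, 0 < δ → ∃ S₀ : ℝ, 0 < S₀ ∧ ∀ S : ℝ, S₀ ≤ S → ∃ N₀ : ℕ, ∀ N : ℕ, N₀ ≤ N →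
      |S⁻¹ * ∫ s in (0 : ℝ)..S, Kf N s| ≤ δ := by
    intro δ hδ
    obtain ⟨S₀, hS₀, hS⟩ := H σ hσ hσ₁' θ hθ (fun v : V3 => v 0 * v 1) (by fun_prop)
      ⟨1, 2, MourreKoopmanChargesStressStrongMixing.abs_shearStress_le⟩
      (shearGerm_orth_one hθ) (shearGerm_orth_coord hθ) (shearGerm_orth_norm_sq hθ) Φ φ hφ δ hδ
    refine ⟨S₀, hS₀, fun S hSS => ?_⟩
    obtain ⟨N₀, hN₀⟩ := hS S hSS
    refine ⟨N₀, fun N hN => ?_⟩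
    have key : (fun s : ℝ => ((N : ℝ) + 1) * ∫ z,
        (∫ y, φ y.1 * (fun v : V3 => v 0 * v 1) y.2 ∂(empiricalMeasure ((Φ N).flow (s * ((N : ℝ) + 1) ^ (-(1 / 3 : ℝ))) z))) *
          (∫ y, φ y.1 * (fun v : V3 => v 0 * v 1) y.2 ∂(empiricalMeasure z))
        ∂(localGibbsLaw σ (fun _ => (1 : ℝ)) (fun _ => 0) (fun _ => θ) N (Φ N))) = Kf N := by
      funext s
      rw [hKf, hC]
      dsimp only
      congr 1
      refine integral_congr_ae (Eventually.of_forall fun z => ?_)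
      dsimp only
      rw [integral_shearGerm_empiricalMeasure, integral_shearGerm_empiricalMeasure, mul_comm]
    have h := hN₀ N hN
    rw [key] at h
    exact h
  exact fejer_le_of_cesaro hKm hB0 hKB hces

/-- **Registered stub `stub_kineticStressLinearRung` of crux stmt-AtomisticToContinuum-17740 — THE KINETIC
SHEAR-STRESS LINEAR RUNG OF THE BRIDGE: `OneBodyCompleteness → EquilibriumStressVarianceDecay`.**  The route's
typed crux stmt-9583 (zero Euler-window Drude weight of every one-body field orthogonal to the collision
invariants, Cesàro form under the homogeneous Gibbs law) implies rung C3 of route OneFlightGossipEngine,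
stmt-9531: `lim_{τ→∞} limsup_N (N+1)·E_{G_N}[Ȳ_τ²] = 0` for the window-averaged per-particle kinetic shear stress
`φ(x)v⁰v¹`, for every activity `a₀ > 0` (decorative at fixed particle number), temperature `θ₀ > 0`, small
reduced diameter, every flow family and every continuous weight.  Fejér from Cesàro (§ 1) + the landed
Green–Kubo equivalence `equilibriumStressVarianceDecay_iff_fejer_corr_decay`. [folklore] -/
theorem stub_kineticStressLinearRung : Summit.AtomisticToContinuum.HydrodynamicLimit.Theses.MourreKoopmanCharges.OneBodyCompleteness → Summit.AtomisticToContinuum.HydrodynamicLimit.Theses.OneFlightGossipEngine.EquilibriumStressVarianceDecay := by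
  intro hOBC
  refine equilibriumStressVarianceDecay_iff_fejer_corr_decay.mpr fun a₀ θ₀ ha hθ => ?_
  obtain ⟨σ₀, hσ₀, hF⟩ := fejerStress_of_oneBodyCompleteness hOBC θ₀ hθ
  refine ⟨σ₀, hσ₀, fun σ hσ hσlt Φ φ hφ => ?_⟩
  simp_rw [KineticWindowGronwallNegative.localGibbsLaw_const_activity ha.ne']
  exact hF σ hσ hσlt Φ φ hφ

end Rung

end Summit.AtomisticToContinuum.HydrodynamicLimit.Theorems.LTEInBand

end
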